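import Mathlib.Analysis.Matrix.Spectrum
import Mathlib.Analysis.InnerProductSpace.PiL2
import Mathlib.LinearAlgebra.FiniteDimensional.Lemmas
import Mathlib.Analysis.Real.Sqrt
import Literature.Analysis.InnerProduct.WeinsteinBound
import Summits.Ventures.YMGap.FlowData.MatrixFreeLevelCertificate
import HarnessLib

/-!
# Cluster level certificate: a residual bound on a `k`-dimensional trial space forces `k` eigenvalues

HONEST FRAMING: pure finite-dimensional linear algebra (Mathlib's antitone `Matrix.IsHermitian.eigenvalues₀`).
It is the certificate step a matrix-free (Lanczos) solver needs at a CLUSTER of levels — an exactly or nearly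
degenerate multiplet inside one symmetry block (non-abelian little groups leave 2- and 3-dimensional
irreducible pieces that `±1` characters cannot split) — where the single-vector chain of
`MatrixFreeLevelCertificate` / `FrobeniusDeflationCertificate` stops because the Weinstein balls of
neighbouring Ritz values overlap.  The replacement for Weinstein's inequality is its SUBSPACE form: if
`‖T x − μ x‖ ≤ η ‖x‖` for every `x` of a `k`-dimensional subspace, then at least `k` eigenvalues (counted with
multiplicity, i.e. `k` indices of the enumeration) lie in `[μ − η, μ + η]` (§1,
`finrank_le_card_filter_abs_eigenvalues_sub_le`; proof: a vector of the subspace orthogonal to the fewer than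
`k` eigenvectors inside the interval would violate Parseval for the residual).  §1 also derives the subspace
bound from what a run has: per-vector residuals `‖T yⱼ − μ yⱼ‖ ≤ ρⱼ` and a Gram lower bound
`σ² Σ|cⱼ|² ≤ ‖Σ cⱼ yⱼ‖²` of the (nearly orthonormal) Ritz vectors give `η = (Σ ρⱼ²)^{1/2} / σ`
(`le_card_filter_of_residuals`).  §2 is the index bookkeeping for an arbitrary real sequence on `Fin N`:
`k` terms in `[lo, hi]`, all terms of index `< t` above `hi`, all terms of index `≥ t + k` below `lo` ⇒ the
terms `t, …, t+k−1` are exactly the ones in `[lo, hi]` (`mem_Icc_of_card_of_isolated`); and, for an antitone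
sequence, the count plus the isolation from above already give `lo ≤ f_j` for every `j < t + k`
(`le_of_card_of_above`) — the lower bounds that the Frobenius-mass test of `FrobeniusDeflation.forall_lt_of_
frobenius` needs to supply the isolation from below without any reference point.  §3 states the matrix
forms for a real symmetric matrix in coordinates (`toEuclideanLin`, `toLp 2`), ready to be fed by the float
residuals and a-priori error norms of `MatvecChainErrorBound`.  Which run feeds which numbers is an audit
witness, not a theorem; nothing here is a lattice, continuum or Clay statement.

## References
* [Parlett1998] B. N. Parlett, *The Symmetric Eigenvalue Problem*, SIAM Classics 20 (1998) — Thm 4.5.1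
  (one vector), §11.5 (Kahan's residual bound for clustered Ritz values: `k` eigenvalues within `‖R‖` of the
  `k` Ritz values of an orthonormal `n × k` trial basis).
* [HornJohnson2013] R. A. Horn, C. R. Johnson, *Matrix Analysis*, 2nd ed., CUP 2013 — Thm 6.3.14.
-/

noncomputable section

open scoped InnerProductSpace
open Module Finset Matrix WithLp Literature.Analysis.InnerProduct

namespace Summit.Ventures.YMGap.FlowData

namespace ClusterLevel

/-! ### §1 Subspace form of Weinstein's inequality -/

section Operator

variable {𝕜 : Type*} [RCLike 𝕜] {E : Type*} [NormedAddCommGroup E] [InnerProductSpace 𝕜 E]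
  [FiniteDimensional 𝕜 E] {T : E →ₗ[𝕜] E} {n : ℕ}

/-- **Subspace Weinstein bound (count form).** If a symmetric `T` satisfies `‖T x − μ x‖ ≤ η‖x‖` for every
`x` of a subspace `S`, then at least `dim S` indices `i` of the eigenvalue enumeration have `|λᵢ − μ| ≤ η`.
[cite: Parlett1998, §11.5; HornJohnson2013, Thm 6.3.14] -/
theorem finrank_le_card_filter_abs_eigenvalues_sub_le (hT : T.IsSymmetric) (hn : finrank 𝕜 E = n)
    (S : Submodule 𝕜 E) {μ η : ℝ} (h : ∀ x ∈ S, ‖T x - (μ : 𝕜) • x‖ ≤ η * ‖x‖) :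
    finrank 𝕜 S ≤ (univ.filter fun i : Fin n => |hT.eigenvalues hn i - μ| ≤ η).card := by
  classical
  set J : Finset (Fin n) := univ.filter fun i : Fin n => |hT.eigenvalues hn i - μ| ≤ η with hJ
  by_contra hlt
  push Not at hlt
  -- the coefficient map `x ↦ (⟪b_i, x⟫)_{i ∈ J}` on `S` has a non-trivial kernel
  set b := hT.eigenvectorBasis hn with hb
  let φ : S →ₗ[𝕜] (J → 𝕜) := LinearMap.pi fun i : J => (innerₛₗ 𝕜 (b i : E)).comp S.subtype
  have hdim : finrank 𝕜 (J → 𝕜) < finrank 𝕜 S := by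
    rw [Module.finrank_fintype_fun_eq_card, Fintype.card_coe]
    exact hlt
  obtain ⟨x, hxker, hx0⟩ :=
    Submodule.exists_mem_ne_zero_of_ne_bot (LinearMap.ker_ne_bot_of_finrank_lt (f := φ) hdim)
  have hφ : ∀ i ∈ J, ⟪(b i : E), (x : E)⟫_𝕜 = 0 := by
    intro i hi
    have := congr_fun (LinearMap.mem_ker.1 hxker) ⟨i, hi⟩
    simpa [φ] using this
  have hxE : (x : E) ≠ 0 := fun h0 => hx0 (Subtype.ext h0)
  -- Parseval for the residual and for `x`, both supported off `J`
  have hres := norm_sq_sub_smul_apply_eq_sum hT hn (x : E) μ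
  have hpars : ‖(x : E)‖ ^ 2 = ∑ i, ‖⟪(b i : E), (x : E)⟫_𝕜‖ ^ 2 :=
    ((hT.eigenvectorBasis hn).sum_sq_norm_inner_right (x : E)).symm
  -- some coefficient outside `J` is non-zero
  have hex : ∃ i ∈ univ.filter (fun i => i ∉ J), 0 < ‖⟪(b i : E), (x : E)⟫_𝕜‖ ^ 2 := by
    by_contra hnone
    push Not at hnone
    have hzero : ∑ i, ‖⟪(b i : E), (x : E)⟫_𝕜‖ ^ 2 = 0 := by
      refine Finset.sum_eq_zero fun i _ => ?_
      by_cases hi : i ∈ J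
      · rw [hφ i hi, norm_zero]; ring
      · exact le_antisymm (hnone i (by simp [hi])) (sq_nonneg _)
    rw [← hpars] at hzero
    exact hxE (by simpa using hzero)
  -- strict comparison of the two Parseval sums
  have hlt2 : η ^ 2 * ‖(x : E)‖ ^ 2 < ‖T x - (μ : 𝕜) • (x : E)‖ ^ 2 := by
    rw [hres, hpars, Finset.mul_sum]
    have hsplit : ∀ (g : Fin n → ℝ), ∑ i, g i * ‖⟪(b i : E), (x : E)⟫_𝕜‖ ^ 2 =
        ∑ i ∈ univ.filter (fun i => i ∉ J), g i * ‖⟪(b i : E), (x : E)⟫_𝕜‖ ^ 2 := by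
      intro g
      rw [← Finset.sum_filter_add_sum_filter_not univ (fun i => i ∉ J)]
      simp only [not_not]
      rw [add_eq_left]
      refine Finset.sum_eq_zero fun i hi => ?_
      rw [hφ i (Finset.mem_filter.1 hi).2, norm_zero]; ring
    rw [hsplit (fun _ => η ^ 2), hsplit (fun i => (hT.eigenvalues hn i - μ) ^ 2)]
    obtain ⟨i₀, hi₀, hpos⟩ := hex
    refine Finset.sum_lt_sum (fun i hi => ?_) ⟨i₀, hi₀, ?_⟩
    · refine mul_le_mul_of_nonneg_right ?_ (sq_nonneg _)
      have hgt : η < |hT.eigenvalues hn i - μ| := by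
        have := (Finset.mem_filter.1 hi).2
        rw [hJ, Finset.mem_filter] at this
        push Not at this
        exact this (mem_univ i)
      by_cases hη : 0 ≤ η
      · rw [← sq_abs (hT.eigenvalues hn i - μ)]
        exact pow_le_pow_left₀ hη hgt.le 2
      · push Not at hη
        -- impossible: the hypothesis on `x` forces `0 ≤ η ‖x‖`
        have := (norm_nonneg _).trans (h x x.2)
        nlinarith [norm_pos_iff.2 hxE]
    · refine mul_lt_mul_of_pos_right ?_ hpos
      have hgt : η < |hT.eigenvalues hn i₀ - μ| := by
        have := (Finset.mem_filter.1 hi₀).2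
        rw [hJ, Finset.mem_filter] at this
        push Not at this
        exact this (mem_univ i₀)
      have hη : 0 ≤ η := by
        have := (norm_nonneg _).trans (h x x.2)
        nlinarith [norm_pos_iff.2 hxE]
      rw [← sq_abs (hT.eigenvalues hn i₀ - μ)]
      exact pow_lt_pow_left₀ hgt hη two_ne_zero
  have hle2 : ‖T x - (μ : 𝕜) • (x : E)‖ ^ 2 ≤ η ^ 2 * ‖(x : E)‖ ^ 2 := by
    rw [← mul_pow]
    exact pow_le_pow_left₀ (norm_nonneg _) (h x x.2) 2
  exact absurd (hlt2.trans_le hle2) (lt_irrefl _)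

/-- **From per-vector residuals to the subspace bound.** Trial vectors `y₀, …, y_{k−1}` with residuals
`‖T yⱼ − μ yⱼ‖ ≤ ρⱼ` and a Gram lower bound `σ² Σ‖cⱼ‖² ≤ ‖Σ cⱼ yⱼ‖²` (`σ > 0`; for an orthonormal family
`σ = 1`) give `‖T x − μ x‖ ≤ ((Σ ρⱼ²)^{1/2}/σ) ‖x‖` on their span, hence at least `k` indices with
`|λᵢ − μ| ≤ (Σ ρⱼ²)^{1/2}/σ`. [cite: Parlett1998, §11.5] -/
theorem le_card_filter_of_residuals (hT : T.IsSymmetric) (hn : finrank 𝕜 E = n) {k : ℕ}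
    (y : Fin k → E) {μ σ : ℝ} {ρ : Fin k → ℝ} (hσ : 0 < σ)
    (hres : ∀ j, ‖T (y j) - (μ : 𝕜) • y j‖ ≤ ρ j)
    (hgram : ∀ c : Fin k → 𝕜, σ ^ 2 * ∑ j, ‖c j‖ ^ 2 ≤ ‖∑ j, c j • y j‖ ^ 2) :
    k ≤ (univ.filter fun i : Fin n =>
      |hT.eigenvalues hn i - μ| ≤ Real.sqrt (∑ j, ρ j ^ 2) / σ).card := by
  -- the family is linearly independent, so its span has dimension `k`
  have hli : LinearIndependent 𝕜 y := by
    rw [Fintype.linearIndependent_iff]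
    intro c hc j
    have h0 : σ ^ 2 * ∑ j, ‖c j‖ ^ 2 ≤ 0 := by simpa [hc] using hgram c
    have hsum : ∑ j, ‖c j‖ ^ 2 ≤ 0 := by
      by_contra hpos
      push Not at hpos
      nlinarith [mul_pos (pow_pos hσ 2) hpos]
    have hj := (Finset.sum_eq_zero_iff_of_nonneg (fun j _ => sq_nonneg ‖c j‖)).1
      (le_antisymm hsum (Finset.sum_nonneg fun j _ => sq_nonneg _)) j (mem_univ j)
    exact norm_eq_zero.1 (pow_eq_zero_iff two_ne_zero |>.1 hj)
  have hdim : finrank 𝕜 (Submodule.span 𝕜 (Set.range y)) = k := by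
    rw [finrank_span_eq_card hli, Fintype.card_fin]
  refine hdim.symm.le.trans (finrank_le_card_filter_abs_eigenvalues_sub_le hT hn _ fun x hx => ?_)
  obtain ⟨c, rfl⟩ := (Submodule.mem_span_range_iff_exists_fun 𝕜).1 hx
  -- residual of the combination
  have hlin : T (∑ j, c j • y j) - (μ : 𝕜) • ∑ j, c j • y j = ∑ j, c j • (T (y j) - (μ : 𝕜) • y j) := by
    simp only [map_sum, map_smul, Finset.smul_sum, smul_sub, smul_smul, mul_comm (c _) (μ : 𝕜),
      Finset.sum_sub_distrib]
  have h1 : ‖T (∑ j, c j • y j) - (μ : 𝕜) • ∑ j, c j • y j‖ ≤ ∑ j, ‖c j‖ * ρ j := by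
    rw [hlin]
    refine (norm_sum_le _ _).trans (Finset.sum_le_sum fun j _ => ?_)
    rw [norm_smul]
    exact mul_le_mul_of_nonneg_left (hres j) (norm_nonneg _)
  have h2 : ∑ j, ‖c j‖ * ρ j ≤ Real.sqrt (∑ j, ‖c j‖ ^ 2) * Real.sqrt (∑ j, ρ j ^ 2) :=
    Real.sum_mul_le_sqrt_mul_sqrt _ _ _
  have h3 : σ * Real.sqrt (∑ j, ‖c j‖ ^ 2) ≤ ‖∑ j, c j • y j‖ := by
    have : Real.sqrt (σ ^ 2 * ∑ j, ‖c j‖ ^ 2) ≤ Real.sqrt (‖∑ j, c j • y j‖ ^ 2) :=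
      Real.sqrt_le_sqrt (hgram c)
    rwa [Real.sqrt_mul (sq_nonneg _), Real.sqrt_sq hσ.le, Real.sqrt_sq (norm_nonneg _)] at this
  have hS0 : 0 ≤ Real.sqrt (∑ j, ρ j ^ 2) := Real.sqrt_nonneg _
  calc ‖T (∑ j, c j • y j) - (μ : 𝕜) • ∑ j, c j • y j‖
      ≤ Real.sqrt (∑ j, ‖c j‖ ^ 2) * Real.sqrt (∑ j, ρ j ^ 2) := h1.trans h2
    _ ≤ (‖∑ j, c j • y j‖ / σ) * Real.sqrt (∑ j, ρ j ^ 2) := by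
        refine mul_le_mul_of_nonneg_right ?_ hS0
        rw [le_div_iff₀ hσ, mul_comm]
        exact h3
    _ = Real.sqrt (∑ j, ρ j ^ 2) / σ * ‖∑ j, c j • y j‖ := by ring

end Operator

/-! ### §2 Index bookkeeping: a window of `k` consecutive levels -/

section Window

variable {N : ℕ} {f : Fin N → ℝ}

/-- The indices carrying a value in `[lo, hi]` all lie in the window `[t, t + k)` when every index `< t`
is above `hi` and every index `≥ t + k` is below `lo`. [folklore] -/
theorem filter_subset_window {t k : ℕ} {lo hi : ℝ} (habove : ∀ j : Fin N, (j : ℕ) < t → hi < f j)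
    (hbelow : ∀ j : Fin N, t + k ≤ (j : ℕ) → f j < lo) :
    (univ.filter fun i : Fin N => f i ∈ Set.Icc lo hi) ⊆
      univ.filter fun i : Fin N => t ≤ (i : ℕ) ∧ (i : ℕ) < t + k := by
  intro i hi
  simp only [Finset.mem_filter, Finset.mem_univ, true_and, Set.mem_Icc] at hi ⊢
  constructor
  · by_contra hlt
    exact absurd hi.2 (not_le.2 (habove i (by omega)))
  · by_contra hge
    exact absurd hi.1 (not_le.2 (hbelow i (by omega)))

/-- The window `[t, t + k)` of `Fin N` has at most `k` indices. [folklore] -/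
theorem card_window_le (t k : ℕ) :
    (univ.filter fun i : Fin N => t ≤ (i : ℕ) ∧ (i : ℕ) < t + k).card ≤ k := by
  calc (univ.filter fun i : Fin N => t ≤ (i : ℕ) ∧ (i : ℕ) < t + k).card ≤ (Finset.Ico t (t + k)).card :=
        Finset.card_le_card_of_injOn (fun i : Fin N => (i : ℕ))
          (fun i hi => by
            simp only [Finset.coe_filter, Finset.mem_univ, true_and, Set.mem_setOf_eq] at hi
            simpa [Finset.mem_Ico] using hi)
          (fun i _ j _ hij => Fin.ext hij)
    _ = k := by simp

/-- **Cluster localisation.** If at least `k` terms of `f` lie in `[lo, hi]`, every term of index `< t` is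
`> hi` and every term of index `≥ t + k` is `< lo`, then the terms of index `t, …, t + k − 1` lie in
`[lo, hi]`. [folklore] -/
theorem mem_Icc_of_card_of_isolated {t k : ℕ} {lo hi : ℝ}
    (hcount : k ≤ (univ.filter fun i : Fin N => f i ∈ Set.Icc lo hi).card)
    (habove : ∀ j : Fin N, (j : ℕ) < t → hi < f j) (hbelow : ∀ j : Fin N, t + k ≤ (j : ℕ) → f j < lo)
    (j : Fin N) (hj₁ : t ≤ (j : ℕ)) (hj₂ : (j : ℕ) < t + k) : f j ∈ Set.Icc lo hi := by
  have hsub := filter_subset_window (f := f) habove hbelow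
  have heq := Finset.eq_of_subset_of_card_le hsub ((card_window_le t k).trans hcount)
  have hjW : j ∈ univ.filter fun i : Fin N => t ≤ (i : ℕ) ∧ (i : ℕ) < t + k := by simp [hj₁, hj₂]
  rw [← heq] at hjW
  exact (Finset.mem_filter.1 hjW).2

/-- **Lower bounds before the below-test.** For an ANTITONE `f`: if at least `k` terms lie in `[lo, hi]`
and every term of index `< t` is `> hi`, then `lo ≤ f j` for every `j < t + k` (the `k` terms in the
interval have indices `≥ t`, so some such index is `≥ t + k − 1`). These are the lower bounds `m_j` the
Frobenius-mass test needs for the levels of the cluster. [folklore] -/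
theorem le_of_card_of_above (hf : Antitone f) {t k : ℕ} (hk : 0 < k) {lo hi : ℝ}
    (hcount : k ≤ (univ.filter fun i : Fin N => f i ∈ Set.Icc lo hi).card)
    (habove : ∀ j : Fin N, (j : ℕ) < t → hi < f j) (j : Fin N) (hj : (j : ℕ) < t + k) : lo ≤ f j := by
  by_contra hlt
  push Not at hlt
  -- every index in the interval is `≥ t` (above) and `< j` (antitone), a window of fewer than `k` indices
  have hsub : (univ.filter fun i : Fin N => f i ∈ Set.Icc lo hi) ⊆
      univ.filter fun i : Fin N => t ≤ (i : ℕ) ∧ (i : ℕ) < t + ((j : ℕ) - t) := by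
    intro i hi
    simp only [Finset.mem_filter, Finset.mem_univ, true_and, Set.mem_Icc] at hi ⊢
    have hit : t ≤ (i : ℕ) := by
      by_contra h
      exact absurd hi.2 (not_le.2 (habove i (by omega)))
    refine ⟨hit, ?_⟩
    have hij : (i : ℕ) < (j : ℕ) := by
      by_contra h
      have hle : f i ≤ f j := hf (Fin.le_iff_val_le_val.2 (by omega))
      exact absurd (hi.1.trans hle) (not_le.2 hlt)
    omega
  have := (Finset.card_le_card hsub).trans (card_window_le t ((j : ℕ) - t))
  omega

end Window

/-! ### §3 Real symmetric matrices in coordinates -/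

section MatrixForm

variable {n : Type*} [Fintype n] [DecidableEq n] {A : Matrix n n ℝ}

/-- **Cluster count for a real symmetric matrix.** Trial vectors `y₀, …, y_{k−1} : n → ℝ` with residuals
`‖A yⱼ − μ yⱼ‖ ≤ ρⱼ` and Gram lower bound `σ² Σ cⱼ² ≤ ‖Σ cⱼ yⱼ‖²` (`σ > 0`) ⇒ at least `k` indices of
Mathlib's antitone enumeration satisfy `|λ↓ᵢ(A) − μ| ≤ (Σ ρⱼ²)^{1/2}/σ`.
[cite: Parlett1998, §11.5; HornJohnson2013, Thm 6.3.14] -/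
theorem le_card_filter_eigenvalues₀_of_residuals (hA : A.IsHermitian) {k : ℕ} (y : Fin k → n → ℝ)
    {μ σ : ℝ} {ρ : Fin k → ℝ} (hσ : 0 < σ)
    (hres : ∀ j, ‖toEuclideanLin A (toLp 2 (y j)) - μ • toLp 2 (y j)‖ ≤ ρ j)
    (hgram : ∀ c : Fin k → ℝ, σ ^ 2 * ∑ j, c j ^ 2 ≤
      ‖(toLp 2 (∑ j, c j • y j) : EuclideanSpace ℝ n)‖ ^ 2) :
    k ≤ (univ.filter fun i : Fin (Fintype.card n) =>
      |hA.eigenvalues₀ i - μ| ≤ Real.sqrt (∑ j, ρ j ^ 2) / σ).card := by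
  have hT : (toEuclideanLin A).IsSymmetric := isSymmetric_toEuclideanLin_iff.mpr hA
  have h := le_card_filter_of_residuals hT finrank_euclideanSpace
    (fun j => (toLp 2 (y j) : EuclideanSpace ℝ n)) hσ (fun j => by simpa using hres j)
    (fun c => by
      have e : (∑ j, c j • (toLp 2 (y j) : EuclideanSpace ℝ n)) = toLp 2 (∑ j, c j • y j) := by
        rw [WithLp.toLp_sum]
        simp only [WithLp.toLp_smul]
      rw [e]
      simpa [Real.norm_eq_abs, sq_abs] using hgram c)
  exact h

omit [DecidableEq n] in
/-- **Gram lower bound from an exact certificate of the small Gram matrix.** If `G = (yᵢ ⬝ yⱼ)ᵢⱼ`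
satisfies `G − σ²·1 ⪰ 0` (a `k × k` check, e.g. by exact rational `LDLᵀ`), then `σ² Σ cⱼ² ≤ ‖Σ cⱼ yⱼ‖²`
for every coefficient vector `c` — the hypothesis `hgram` below. [folklore] -/
theorem gram_lower_of_posSemidef {k : ℕ} (y : Fin k → n → ℝ) {σ : ℝ}
    (hpsd : (Matrix.of (fun i j : Fin k => y i ⬝ᵥ y j) - σ ^ 2 • (1 : Matrix (Fin k) (Fin k) ℝ)).PosSemidef)
    (c : Fin k → ℝ) :
    σ ^ 2 * ∑ j, c j ^ 2 ≤ ‖(toLp 2 (∑ j, c j • y j) : EuclideanSpace ℝ n)‖ ^ 2 := by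
  have h := hpsd.dotProduct_mulVec_nonneg c
  have hG : c ⬝ᵥ (Matrix.of (fun i j : Fin k => y i ⬝ᵥ y j) *ᵥ c) =
      (∑ j, c j • y j) ⬝ᵥ (∑ j, c j • y j) := by
    simp only [sum_dotProduct, smul_dotProduct, dotProduct_sum, dotProduct_smul, smul_eq_mul]
    simp only [Matrix.mulVec, dotProduct, Matrix.of_apply]
    refine Finset.sum_congr rfl fun i _ => ?_
    rw [Finset.mul_sum, Finset.mul_sum]
    refine Finset.sum_congr rfl fun j _ => ?_
    rw [show (∑ x, y j x * y i x) = ∑ x, y i x * y j x from Finset.sum_congr rfl fun x _ => mul_comm _ _]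
    ring
  have hn2 : ‖(toLp 2 (∑ j, c j • y j) : EuclideanSpace ℝ n)‖ ^ 2 =
      (∑ j, c j • y j) ⬝ᵥ (∑ j, c j • y j) := by
    rw [MatrixFreeLevel.norm_sq_toLp_eq_sum]
    simp only [dotProduct, pow_two]
  have hcc : c ⬝ᵥ c = ∑ j, c j ^ 2 := by simp only [dotProduct, pow_two]
  rw [star_trivial, Matrix.sub_mulVec, dotProduct_sub, Matrix.smul_mulVec, Matrix.one_mulVec,
    dotProduct_smul, smul_eq_mul, hG, hcc] at h
  rw [hn2]
  linarith

/-- **Cluster certificate** (index-wise): `k` trial vectors as above, the levels of index `< t` certified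
`> μ + η` and the levels of index `≥ t + k` certified `< μ − η` (`η = (Σρⱼ²)^{1/2}/σ`) ⇒
`λ↓_j(A) ∈ [μ − η, μ + η]` for every `j = t, …, t + k − 1`. [cite: Parlett1998, §11.5] -/
theorem eigenvalues₀_mem_Icc_of_cluster (hA : A.IsHermitian) {k : ℕ} (y : Fin k → n → ℝ)
    {μ σ : ℝ} {ρ : Fin k → ℝ} (hσ : 0 < σ)
    (hres : ∀ j, ‖toEuclideanLin A (toLp 2 (y j)) - μ • toLp 2 (y j)‖ ≤ ρ j)
    (hgram : ∀ c : Fin k → ℝ, σ ^ 2 * ∑ j, c j ^ 2 ≤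
      ‖(toLp 2 (∑ j, c j • y j) : EuclideanSpace ℝ n)‖ ^ 2)
    {t : ℕ} (habove : ∀ j : Fin (Fintype.card n), (j : ℕ) < t →
      μ + Real.sqrt (∑ j, ρ j ^ 2) / σ < hA.eigenvalues₀ j)
    (hbelow : ∀ j : Fin (Fintype.card n), t + k ≤ (j : ℕ) →
      hA.eigenvalues₀ j < μ - Real.sqrt (∑ j, ρ j ^ 2) / σ)
    (j : Fin (Fintype.card n)) (hj₁ : t ≤ (j : ℕ)) (hj₂ : (j : ℕ) < t + k) :
    hA.eigenvalues₀ j ∈ Set.Icc (μ - Real.sqrt (∑ j, ρ j ^ 2) / σ) (μ + Real.sqrt (∑ j, ρ j ^ 2) / σ) := by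
  have hcount := le_card_filter_eigenvalues₀_of_residuals hA y hσ hres hgram
  have hcount' : k ≤ (univ.filter fun i : Fin (Fintype.card n) => hA.eigenvalues₀ i ∈
      Set.Icc (μ - Real.sqrt (∑ j, ρ j ^ 2) / σ) (μ + Real.sqrt (∑ j, ρ j ^ 2) / σ)).card := by
    refine hcount.trans (Finset.card_le_card fun i hi => ?_)
    simp only [Finset.mem_filter, Finset.mem_univ, true_and, Set.mem_Icc] at hi ⊢
    constructor <;> linarith [(abs_le.1 hi).1, (abs_le.1 hi).2]
  exact mem_Icc_of_card_of_isolated hcount' habove hbelow j hj₁ hj₂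

/-- **Lower bounds for the cluster levels from the count and the isolation from above** (antitone
enumeration): `μ − η ≤ λ↓_j(A)` for all `j < t + k`. Feed these as the `m_j` of
`FrobeniusDeflation.forall_lt_of_frobenius` to obtain the isolation from below. [cite: Parlett1998, §11.5] -/
theorem sub_le_eigenvalues₀_of_cluster_of_above (hA : A.IsHermitian) {k : ℕ} (hk : 0 < k)
    (y : Fin k → n → ℝ) {μ σ : ℝ} {ρ : Fin k → ℝ} (hσ : 0 < σ)
    (hres : ∀ j, ‖toEuclideanLin A (toLp 2 (y j)) - μ • toLp 2 (y j)‖ ≤ ρ j)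
    (hgram : ∀ c : Fin k → ℝ, σ ^ 2 * ∑ j, c j ^ 2 ≤
      ‖(toLp 2 (∑ j, c j • y j) : EuclideanSpace ℝ n)‖ ^ 2)
    {t : ℕ} (habove : ∀ j : Fin (Fintype.card n), (j : ℕ) < t →
      μ + Real.sqrt (∑ j, ρ j ^ 2) / σ < hA.eigenvalues₀ j)
    (j : Fin (Fintype.card n)) (hj : (j : ℕ) < t + k) :
    μ - Real.sqrt (∑ j, ρ j ^ 2) / σ ≤ hA.eigenvalues₀ j := by
  have hcount := le_card_filter_eigenvalues₀_of_residuals hA y hσ hres hgram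
  have hcount' : k ≤ (univ.filter fun i : Fin (Fintype.card n) => hA.eigenvalues₀ i ∈
      Set.Icc (μ - Real.sqrt (∑ j, ρ j ^ 2) / σ) (μ + Real.sqrt (∑ j, ρ j ^ 2) / σ)).card := by
    refine hcount.trans (Finset.card_le_card fun i hi => ?_)
    simp only [Finset.mem_filter, Finset.mem_univ, true_and, Set.mem_Icc] at hi ⊢
    constructor <;> linarith [(abs_le.1 hi).1, (abs_le.1 hi).2]
  exact le_of_card_of_above hA.eigenvalues₀_antitone hk hcount' habove j hj

end MatrixForm

/-! ### §4 Index range from two eigenvalue counts (clusters in the exact inertia certificate) -/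

section Counts

/-- **Counts ⇒ index range.** For an antitone `f : Fin N → ℝ`: if exactly `ca` terms exceed `a` and exactly
`cb` exceed `b`, then `f j ∈ (a, b]` for EVERY `cb ≤ j < ca` — the two exact inertia counts of `a·1 − W` and
`b·1 − W` bracket all `ca − cb` levels of a (possibly degenerate) cluster at once; `ca = j+1, cb = j` is the
tree's `Literature.Analysis.Matrix.EigenvalueCount.eigenvalues₀_mem_Ioc_of_card_eq`. [cite: GolubVanLoan2013, §8.4.2] -/
theorem mem_Ioc_of_card_filter_eq {N : ℕ} {f : Fin N → ℝ} (hf : Antitone f) {a b : ℝ} {ca cb : ℕ}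
    (ha : (univ.filter fun i : Fin N => a < f i).card = ca) (hb : (univ.filter fun i : Fin N => b < f i).card = cb)
    (j : Fin N) (h₁ : cb ≤ (j : ℕ)) (h₂ : (j : ℕ) < ca) : f j ∈ Set.Ioc a b := by
  refine ⟨lt_of_not_ge fun hle => ?_, le_of_not_gt fun hlt => ?_⟩
  · have hsub : (univ.filter fun i : Fin N => a < f i) ⊆ Finset.Iio j := fun i hi =>
      Finset.mem_Iio.2 (lt_of_not_ge fun hij => absurd ((mem_filter.1 hi).2.trans_le (hf hij)) (not_lt.2 hle))
    have := card_le_card hsub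
    rw [Fin.card_Iio, ha] at this; omega
  · have hsub : Finset.Iic j ⊆ (univ.filter fun i : Fin N => b < f i) := fun i hi =>
      mem_filter.2 ⟨mem_univ i, hlt.trans_le (hf (Finset.mem_Iic.1 hi))⟩
    have := card_le_card hsub
    rw [Fin.card_Iic, hb] at this; omega

/-- **Matrix form** (Mathlib's antitone `eigenvalues₀`): counts `#{i | a < λ↓ᵢ} = ca`, `#{i | b < λ↓ᵢ} = cb` —
from the negative pivots of exact `LDLᵀ` factorizations of `a·1 − W`, `b·1 − W` via the tree's
`EigenvalueCount.card_eigenvalues_gt_eq_card_neg_of_sub` + `card_filter_eigenvalues_eq` — give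
`λ↓_j(W) ∈ (a, b]` for all `cb ≤ j < ca`. [cite: GolubVanLoan2013, §8.4.2] -/
theorem eigenvalues₀_mem_Ioc_of_card_filter_eq {n : Type*} [Fintype n] [DecidableEq n] {A : Matrix n n ℝ}
    (hA : A.IsHermitian) {a b : ℝ} {ca cb : ℕ}
    (ha : (univ.filter fun i : Fin (Fintype.card n) => a < hA.eigenvalues₀ i).card = ca)
    (hb : (univ.filter fun i : Fin (Fintype.card n) => b < hA.eigenvalues₀ i).card = cb)
    (j : Fin (Fintype.card n)) (h₁ : cb ≤ (j : ℕ)) (h₂ : (j : ℕ) < ca) : hA.eigenvalues₀ j ∈ Set.Ioc a b :=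
  mem_Ioc_of_card_filter_eq hA.eigenvalues₀_antitone ha hb j h₁ h₂

end Counts

end ClusterLevel

end Summit.Ventures.YMGap.FlowData
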